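import Mathlib.RingTheory.AlgebraicIndependent.Adjoin
import Mathlib.RingTheory.AlgebraicIndependent.TranscendenceBasis
import Mathlib.RingTheory.Localization.FractionRing
import Literature.Barriers.KontsevichZagierPeriods.GrothendieckPeriodConjectureDependence
import Literature.Barriers.Schanuel.AlgebraicIndependenceOfLogarithms
import Literature.NumberTheory.Transcendental.KZKernelConjectureForms
import HarnessLib

/-!
# Barrier (Kontsevich–Zagier ⟹ Grothendieck): the elliptic consequent in transcendence-degree
  form, and why `kzConjecture_implies_ellipticPeriods_algIndep` has no `_holds`

Sibling proof file of `GrothendieckPeriodConjectureDependence.lean`, about its named fact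
`Literature.Barriers.KontsevichZagierPeriods.kzConjecture_implies_ellipticPeriods_algIndep`
(the body of the summit `KontsevichZagierPeriods` — Conjecture 1 of Kontsevich–Zagier in the
H21 rules form `∀ r r' rational, r.value = r'.value → KZ.Equivalent r r'` — implies Fresán's
Conjecture 10.4, `EllipticPeriodsAlgIndep`: the four periods `ω₁, ω₂, η₁, η₂` of an elliptic curve
`y² = 4x³ − g₂x − g₃` with `g₂, g₃ ∈ ℚ̄` and without complex multiplication are algebraically
independent over `ℚ`).

## Status of the implication (triage for a discharge: a theory, not a lemma)

The implication is printed as the composite of three results, none of which is a lemma over the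
present tree:

1. *Rules form ⟹ formal (cohomological) period conjecture.* Kontsevich–Zagier assert that
   Conjecture 1 (three rules on integral representations) is equivalent to the injectivity of the
   evaluation `𝒫 → ℂ` on abstract periods `[(X, D, ω, γ)]` [KontsevichZagier2001, §4.1]; Fresán:
   "La conjecture de Kontsevich-Zagier se traduit alors en l'énoncé : Conjecture 10.6.
   L'application `per` est injective." [Fresan2024, §10.4, p. 147]. Relating the naive integral
   representations `Literature.NumberTheory.Transcendental.KZ.IntegralRep` and their moves
   (`KZ.relations`, `Literature/NumberTheory/Transcendental/KZCalculus.lean`) to cohomological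
   periods is the *Period Theorem* [HuberMullerStachPeriods2017, Thm. 12.2.1, §12.2, Rem. 13.1.8],
   which the tree records only as the existence statement
   `Literature.NumberTheory.Transcendental.ExistsCohomologicalPeriodsEqPeriods` over the
   hypothesis structures `PeriodRealization` / `RelativePeriodData` ("a theory, not a lemma",
   `Literature/NumberTheory/Transcendental/CohomologicalPeriods.lean`). The direction needed here
   is the favourable one (fewer formal moves make the antecedent stronger), but using the
   antecedent still requires functionals on `KZ.FormalRep` that are invariant under the moves and
   differ from `KZ.eval` (the twisted evaluations by points of the period torsor), i.e. the
   cohomological interpretation of every integral representation.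
2. *Formal period conjecture ⟹ Grothendieck's conjecture for every motive.* "Dire que
   l'application per est injective (conjecture 10.6) équivaut donc à dire que l'évaluation des
   fonctions sur le torseur des périodes en le point comp est injective … Dire que c'est un point
   générique équivaut donc à dire que le torseur des périodes est connexe et que sa dimension est
   égale au degré de transcendance de ce corps … on retrouve la conjecture 10.1"
   [Fresan2024, §10.4, pp. 147–148]; [HuberMullerStachPeriods2017, Prop. 13.2.6];
   [Ayoub2014, Cor. 32]. Statable only over the interface
   `Literature.AlgebraicGeometry.Motives.NoriMotivicInterface`, which admits junk models, so no
   closed statement is available before the classical instance is constructed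
   (`Literature/AlgebraicGeometry/Motives/NoriInterface.lean`, "WARNING — junk instances").
3. *Grothendieck's conjecture for `H¹(E)`, `E` without CM, is Conjecture 10.4.* "Le théorème 10.8
   et la conjecture 10.4 sont bien des instances de la conjecture des périodes de Grothendieck
   puisque le groupe de Galois motivique de `H¹(E)` est de dimension 2 si `E` est à multiplication
   complexe … et qu'il est égal à `GL₂` sinon." [Fresan2024, §10.3, p. 144], with Conjecture 10.1:
   "Le degré de transcendance du corps engendré par les coefficients de l'accouplement de périodes
   … est égal à la dimension du groupe de Galois motivique" [Fresan2024, §10.2, p. 138]. The tree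
   has no motivic Galois (or Mumford–Tate) group of a variety, so `G_mot(H¹(E)) = GL₂` is not
   statable; what remains of step 3 is the algebra "`trdeg_ℚ ℚ(ω₁, ω₂, η₁, η₂) = 4 = dim GL₂` ⟺
   the four periods are algebraically independent", proved below.

Hence `kzConjecture_implies_ellipticPeriods_algIndep` stays a named fact (its role is that of a
*strength barrier*: any proof of the summit proves Conjecture 10.4, "complètement ouverte à l'heure
actuelle" [Fresan2024, §10.5, p. 149]). No intermediate closed statement exists between its
antecedent and its consequent: Grothendieck's conjecture for non-CM elliptic curves over `ℚ̄`, in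
the only form the tree can state (transcendence degree `4`), is *equivalent* to the consequent
(`ellipticPeriodsAlgIndep_iff_trdeg_eq_four`).

Status of the printed chain, stage by stage (prove-seat audit, 2026-08-15). Stage 1 is *asserted*,
not proved, in every source: Kontsevich–Zagier give no proof of the equivalence of Conjecture 1
with the injectivity of `𝒫 → ℂ` [KontsevichZagier2001, §4.1]; the Period Theorem
[HuberMullerStachPeriods2017, Thm. 12.2.1] compares the *sets* of numbers (naive periods =
cohomological periods), not the two calculi of relations, and already the comparison of
Kontsevich's own formal symbols with the cohomological formal period algebra is flagged as open
fine print ("these symbols generate the algebra, but it is not clear if they also give all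
relations" [Huber2020, Rem. 3.2]; [HuberMullerStachPeriods2017, Rem. 13.1.8];
[HuberWustholz2022, Rem. 13.2 (2)]); no published text sends the four moves of `KZCalculus.lean`
to cohomological relations along a choice-free assignment `IntegralRep ↦ symbol` (the summit's own
route `NoriTransfer` carries the transfer in the opposite direction as open cruxes). Stages 2–3 are
theorems of the theory of Nori motives ([HuberMullerStachPeriods2017, Prop. 13.2.6]; `MT ⊆ G_mot`
via the Hodge realisation and `MT(H¹(E)) = GL₂` for `E` without CM), a theory absent from the tree;
the algebra of stage 3 is proved below. Consequently the discharge is not a transcription of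
printed proofs, and what this file proves instead is the exact *position* of the fact:

* it is implied outright by its consequent, the registered open statement `EllipticPeriodsAlgIndep`
  (`kzConjecture_implies_ellipticPeriods_algIndep_of_ellipticPeriodsAlgIndep`), so the debt is
  dominated by an open conjecture;
* it is the same implication from the kernel form `KZKernelConjecture` (`ker eval = relations`,
  the shape of [HuberMullerStachPeriods2017, Conj. 13.2.1] and of Fresán's Conj. 10.6, where stage 1
  starts) and from the all-algebraic form `KZPeriodConjecture'`
  (`kzConjecture_implies_ellipticPeriods_algIndep_iff_kernelForm`, `…_iff_algebraicForm`);
* the mechanism by which stage 1–3 would use the antecedent is isolated: under Conjecture 1 every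
  additive functional on `KZ.FormalRep` vanishing on the moves vanishes on `ker eval`
  (`moveInvariant_eq_zero_of_kz`) — the twisted evaluations by points of the period torsor are such
  functionals in the motivic theory — and, contrapositively, one move-invariant functional
  separating two representations of the same number refutes the antecedent and would discharge this
  fact vacuously (`not_kz_of_moveInvariant_separating`; the kill criterion of route `NoriTransfer`).

## What is proved here

* `trdeg_fractionRing_mvPolynomial`, `trdeg_adjoin_eq_of_algebraicIndependent`,
  `algebraicIndependent_iff_trdeg_adjoin_eq` — for a finite family `v : Fin n → E` over a field
  `K`: `v` is algebraically independent iff `trdeg_K K(v) = n` (Mathlib's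
  `AlgebraicIndependent.aevalEquivField`, the tower law `trdeg_add_eq`, and the tree's
  `Literature.Barriers.Schanuel.algebraicIndependent_of_le_trdeg_adjoin`).
* `EllipticPeriodsAlgIndep.trdeg_eq_four`, `ellipticPeriodsAlgIndep_iff_trdeg_eq_four` —
  Conjecture 10.4 ⟺ "`trdeg_ℚ ℚ(ω₁, ω₂, η₁, η₂) = 4` for `g₂, g₃` algebraic and no CM", i.e.
  Conjecture 10.1 for `H¹(E)` given `dim G_mot(H¹(E)) = dim GL₂ = 4` [Fresan2024, §10.3, p. 144],
  in the currency of Chudnovsky's theorem `Literature.NumberTheory.Transcendental.chudnovsky`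
  ("degtr `ℚ(ω₁, ω₂, η₁, η₂) ⩾ 2`", [Fresan2024, Thm. 10.8, p. 141]) — the only known result in
  this direction besides Masser's linear independence [Fresan2024, §10.3, p. 144].
* `trdeg_ellipticPeriods_eq_four_of_kz` — the bite of the strength barrier made explicit: under
  the printed implication, a proof of the summit yields `trdeg_ℚ ℚ(ω₁, ω₂, η₁, η₂) = 4` for every
  non-CM lattice with algebraic invariants, where `2` is the proved frontier (Chudnovsky) and
  already `3` is open.
* `EllipticPeriodsAlgIndep.of_not_hasCM` — the consequent in the `¬ HasCM` phrasing of
  `Literature/NumberTheory/Transcendental/OnePeriods.lean` (via `nonCM_iff_not_hasCM`).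
* `kzConjecture_implies_ellipticPeriods_algIndep_of_ellipticPeriodsAlgIndep`,
  `kzConjecture_implies_ellipticPeriods_algIndep_iff_kernelForm`,
  `kzConjecture_implies_ellipticPeriods_algIndep_iff_algebraicForm`,
  `algebraicIndependent_ellipticPeriods_of_kzKernel`, `trdeg_ellipticPeriods_eq_four_of_kzKernel` —
  position of the fact (domination by the open consequent; kernel and algebraic forms of the
  antecedent, by the proved comparison lemmas of `KZKernelConjectureForms.lean`) and the bite in
  kernel form.
* `moveInvariant_eq_zero_of_kz`, `moveInvariant_apply_of_eq_of_kz`,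
  `not_kz_of_moveInvariant_separating` — Conjecture 1 (rules form) forces every move-invariant
  additive functional on formal combinations of integral representations to factor through the
  value; a separating one refutes it.

## References

* [Fresan2024] J. Fresán, *Une introduction aux périodes*, Journées X-UPS 2019 (publ. 2024):
  Conj. 3.1 (p. 32), §10.2 Conj. 10.1 (p. 138), §10.3 Thm. 10.8 (p. 141) and Conj. 10.4 (p. 144),
  §10.4 Conj. 10.6 (pp. 145–148), §10.5 (p. 149).
* [KontsevichZagier2001] M. Kontsevich, D. Zagier, *Periods* (2001), §1.2 Conjecture 1, §4.1.
* [HuberMullerStachPeriods2017] A. Huber, S. Müller-Stach, *Periods and Nori motives* (2017),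
  Thm. 12.2.1, Rem. 13.1.8, Prop. 13.2.6.
* [Ayoub2014] J. Ayoub, *Periods and the conjectures of Grothendieck and Kontsevich–Zagier*,
  EMS Newsl. 91 (2014), Cor. 32.
* [Huber2020] A. Huber, *Galois theory of periods*, Münster J. Math. 13 (2020) (arXiv:1811.06268),
  §3.1 Def. 3.1, Rem. 3.2, Conj. 3.3.
* [HuberWustholz2022] A. Huber, G. Wüstholz, *Transcendence and Linear Relations of 1-Periods*,
  CUP (2022), Conj. 13.1, Rem. 13.2.

## Design notes

* Nothing of `GrothendieckPeriodConjectureDependence.lean` is restated or modified; this file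
  only adds theorems. The transcendence-degree phrasing
  `Algebra.trdeg ℚ ↥(IntermediateField.adjoin ℚ {L.ω₁, L.ω₂, L.η₁, L.η₂})` is literally that of
  `Literature.NumberTheory.Transcendental.chudnovsky`.
* The general lemmas are stated for `Fin n`-indexed families over arbitrary fields `K ⊆ E`
  (universe-polymorphic via `Cardinal.lift`).
* Second instalment (2026-08-15): one more import, `KZKernelConjectureForms` (comparison lemmas
  `kzKernelConjecture_iff_isRational`, `kzPeriodConjecture'_iff_isRational`, whose right-hand sides
  are verbatim the antecedent of the fact); theorems only, nothing above is changed.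
-/

noncomputable section

open Complex Cardinal

namespace Literature.Barriers.KontsevichZagierPeriods

/-! ### Transcendence degree of a finitely generated purely transcendental extension -/

/-- The rational function field `K(X₁, …, Xₙ)` has transcendence degree `n` over `K` (tower law
along `K ⊆ K[X] ⊆ K(X)`, the fraction field being algebraic over the polynomial ring). [folklore] -/
theorem trdeg_fractionRing_mvPolynomial (K : Type*) [Field K] (n : ℕ) :
    Algebra.trdeg K (FractionRing (MvPolynomial (Fin n) K)) = n := by
  haveI : Algebra.IsAlgebraic (MvPolynomial (Fin n) K) (FractionRing (MvPolynomial (Fin n) K)) :=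
    IsLocalization.isAlgebraic _ (nonZeroDivisors (MvPolynomial (Fin n) K))
  have h := trdeg_add_eq K (MvPolynomial (Fin n) K) (A := FractionRing (MvPolynomial (Fin n) K))
  rw [trdeg_eq_zero (R := MvPolynomial (Fin n) K) (A := FractionRing (MvPolynomial (Fin n) K)),
    add_zero, MvPolynomial.trdeg_of_isDomain] at h
  simpa using h.symm

/-- If `v : Fin n → E` is algebraically independent over the subfield `K`, the field `K(v)` it
generates has transcendence degree `n` over `K` (it is `K`-isomorphic to `K(X₁, …, Xₙ)`,
Mathlib's `AlgebraicIndependent.aevalEquivField`). [folklore] -/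
theorem trdeg_adjoin_eq_of_algebraicIndependent {K E : Type*} [Field K] [Field E] [Algebra K E]
    {n : ℕ} {v : Fin n → E} (hv : AlgebraicIndependent K v) :
    Algebra.trdeg K ↥(IntermediateField.adjoin K (Set.range v)) = n := by
  have h := hv.aevalEquivField.lift_trdeg_eq
  rw [trdeg_fractionRing_mvPolynomial] at h
  simpa using h.symm

/-- **A finite family is algebraically independent iff it generates a field of full transcendence
degree**: for `v : Fin n → E`, `AlgebraicIndependent K v ↔ trdeg_K K(v) = n` (the converse is the
tree's `Literature.Barriers.Schanuel.algebraicIndependent_of_le_trdeg_adjoin`). [folklore] -/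
theorem algebraicIndependent_iff_trdeg_adjoin_eq {K E : Type*} [Field K] [Field E] [Algebra K E]
    {n : ℕ} (v : Fin n → E) :
    AlgebraicIndependent K v ↔ Algebra.trdeg K ↥(IntermediateField.adjoin K (Set.range v)) = n :=
  ⟨trdeg_adjoin_eq_of_algebraicIndependent, fun h =>
    Literature.Barriers.Schanuel.algebraicIndependent_of_le_trdeg_adjoin v h.ge⟩

/-! ### Conjecture 10.4 in transcendence-degree form -/

/-- The set of the four periods is the range of the family `![ω₁, ω₂, η₁, η₂]`. [folklore] -/
theorem range_periods_eq (L : PeriodPair) :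
    Set.range ![L.ω₁, L.ω₂, L.η₁, L.η₂] = ({L.ω₁, L.ω₂, L.η₁, L.η₂} : Set ℂ) := by
  ext z
  simp only [Set.mem_range, Set.mem_insert_iff, Set.mem_singleton_iff]
  constructor
  · rintro ⟨i, rfl⟩
    fin_cases i <;> simp
  · rintro (rfl | rfl | rfl | rfl)
    exacts [⟨0, rfl⟩, ⟨1, rfl⟩, ⟨2, rfl⟩, ⟨3, rfl⟩]

/-- **Conjecture 10.4 gives transcendence degree `4`**: if the four periods of a non-CM lattice
with algebraic invariants are algebraically independent, then `trdeg_ℚ ℚ(ω₁, ω₂, η₁, η₂) = 4` —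
the value predicted by Grothendieck's Conjecture 10.1 for `H¹(E)`, "puisque le groupe de Galois
motivique de `H¹(E)` … est égal à `GL₂`" (dimension `4`) when `E` has no complex multiplication;
compare Chudnovsky's `⩾ 2` (`Literature.NumberTheory.Transcendental.chudnovsky`, Thm. 10.8).
[cite: Fresan2024, §10.3 Conj. 10.4 and p. 144] -/
theorem EllipticPeriodsAlgIndep.trdeg_eq_four (h : EllipticPeriodsAlgIndep) (L : PeriodPair)
    (h₂ : IsAlgebraic ℚ L.g₂) (h₃ : IsAlgebraic ℚ L.g₃) (hCM : NonCM L) :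
    Algebra.trdeg ℚ ↥(IntermediateField.adjoin ℚ ({L.ω₁, L.ω₂, L.η₁, L.η₂} : Set ℂ)) = 4 := by
  rw [← range_periods_eq]
  exact_mod_cast trdeg_adjoin_eq_of_algebraicIndependent (h L h₂ h₃ hCM)

/-- **Conjecture 10.4 ⟺ Grothendieck's conjecture for non-CM elliptic curves over `ℚ̄` in
transcendence-degree form**: the four periods of every non-CM lattice with algebraic `g₂, g₃` are
algebraically independent iff for every such lattice `trdeg_ℚ ℚ(ω₁, ω₂, η₁, η₂) = 4`
(`= dim GL₂ = dim G_mot(H¹(E))`, Conj. 10.1 for `H¹(E)`). This is the only part of the passage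
"Grothendieck's conjecture for `H¹(E)` ⟹ Conjecture 10.4" that the tree can state, and it shows
that no closed statement lies strictly between them. [cite: Fresan2024, §10.2 Conj. 10.1 and §10.3 p. 144] -/
theorem ellipticPeriodsAlgIndep_iff_trdeg_eq_four :
    EllipticPeriodsAlgIndep ↔
      ∀ L : PeriodPair, IsAlgebraic ℚ L.g₂ → IsAlgebraic ℚ L.g₃ → NonCM L →
        Algebra.trdeg ℚ ↥(IntermediateField.adjoin ℚ ({L.ω₁, L.ω₂, L.η₁, L.η₂} : Set ℂ)) = 4 := by
  refine ⟨fun h L h₂ h₃ hCM => h.trdeg_eq_four L h₂ h₃ hCM, fun h L h₂ h₃ hCM => ?_⟩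
  refine (algebraicIndependent_iff_trdeg_adjoin_eq _).2 ?_
  rw [range_periods_eq]
  exact_mod_cast h L h₂ h₃ hCM

/-- The consequent in the `¬ HasCM` phrasing of `Literature/NumberTheory/Transcendental/OnePeriods.lean`
(`masser_ellipticPeriods`, `HuberWustholzOnePeriods`): under Conjecture 10.4, a lattice with
algebraic invariants and `¬ L.HasCM` has algebraically independent periods. [cite: Fresan2024, Conj. 10.4] -/
theorem EllipticPeriodsAlgIndep.of_not_hasCM (h : EllipticPeriodsAlgIndep) (L : PeriodPair)
    (h₂ : IsAlgebraic ℚ L.g₂) (h₃ : IsAlgebraic ℚ L.g₃) (hCM : ¬ L.HasCM) :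
    AlgebraicIndependent ℚ ![L.ω₁, L.ω₂, L.η₁, L.η₂] :=
  h L h₂ h₃ ((nonCM_iff_not_hasCM L).2 hCM)

/-! ### The bite of the strength barrier, in Chudnovsky's currency -/

/-- **Under the printed implication, the summit forces `trdeg_ℚ ℚ(ω₁, ω₂, η₁, η₂) = 4`** for
every lattice with algebraic invariants and no complex multiplication — where the proved frontier
is Chudnovsky's `⩾ 2` (`Literature.NumberTheory.Transcendental.chudnovsky`, "Le degré de
transcendance du corps engendré par les périodes de E est au moins 2", Thm. 10.8) and already `⩾ 3`
is open ("la conjecture 10.4 est complètement ouverte à l'heure actuelle", §10.5). The hypothesis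
`hkz` is the body of the summit `KontsevichZagierPeriods`. [cite: Fresan2024, Thm. 10.8, Conj. 10.4, §10.5] -/
theorem trdeg_ellipticPeriods_eq_four_of_kz (h : kzConjecture_implies_ellipticPeriods_algIndep)
    (hkz : ∀ ⦃n m : ℕ⦄ (r : Literature.NumberTheory.Transcendental.KZ.IntegralRep n)
      (r' : Literature.NumberTheory.Transcendental.KZ.IntegralRep m),
      r.IsRational → r'.IsRational → r.value = r'.value →
        Literature.NumberTheory.Transcendental.KZ.Equivalent r r')
    (L : PeriodPair) (h₂ : IsAlgebraic ℚ L.g₂) (h₃ : IsAlgebraic ℚ L.g₃) (hCM : NonCM L) :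
    Algebra.trdeg ℚ ↥(IntermediateField.adjoin ℚ ({L.ω₁, L.ω₂, L.η₁, L.η₂} : Set ℂ)) = 4 :=
  (h hkz).trdeg_eq_four L h₂ h₃ hCM

/-- **… strictly beyond Chudnovsky**: under the printed implication and the summit, Chudnovsky's
inequality `2 ⩽ trdeg_ℚ ℚ(ω₁, ω₂, η₁, η₂)` becomes strict for non-CM lattices with algebraic
invariants (whereas it is an equality in the CM case, Thm. 10.8). [cite: Fresan2024, Thm. 10.8 and Conj. 10.4] -/
theorem two_lt_trdeg_ellipticPeriods_of_kz (h : kzConjecture_implies_ellipticPeriods_algIndep)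
    (hkz : ∀ ⦃n m : ℕ⦄ (r : Literature.NumberTheory.Transcendental.KZ.IntegralRep n)
      (r' : Literature.NumberTheory.Transcendental.KZ.IntegralRep m),
      r.IsRational → r'.IsRational → r.value = r'.value →
        Literature.NumberTheory.Transcendental.KZ.Equivalent r r')
    (L : PeriodPair) (h₂ : IsAlgebraic ℚ L.g₂) (h₃ : IsAlgebraic ℚ L.g₃) (hCM : NonCM L) :
    (2 : Cardinal) < Algebra.trdeg ℚ ↥(IntermediateField.adjoin ℚ ({L.ω₁, L.ω₂, L.η₁, L.η₂} : Set ℂ)) := by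
  rw [trdeg_ellipticPeriods_eq_four_of_kz h hkz L h₂ h₃ hCM]
  norm_num

/-! ### Position of the fact: dominated by its open consequent; kernel and algebraic forms -/

/-- **The fact follows outright from its consequent, the open Conjecture 10.4.** If the four
periods of every non-CM lattice with algebraic invariants are algebraically independent
(`EllipticPeriodsAlgIndep`, a registered open statement: "la conjecture 10.4 est complètement
ouverte à l'heure actuelle"), then the implication from Conjecture 1 holds trivially; the antecedent
is not used. So the named-fact debt `kzConjecture_implies_ellipticPeriods_algIndep` is dominated by
an open conjecture. [cite: Fresan2024, §10.3 Conj. 10.4 and §10.5 (p. 149)] -/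
theorem kzConjecture_implies_ellipticPeriods_algIndep_of_ellipticPeriodsAlgIndep
    (h : EllipticPeriodsAlgIndep) : kzConjecture_implies_ellipticPeriods_algIndep :=
  fun _ => h

/-- **Kernel form of the barrier.** The fact is equivalently the implication from the kernel form of
Conjecture 1, `KZKernelConjecture` (`ker eval = relations` on formal `ℤ`-combinations of integral
representations — the injectivity shape in which the conjecture is printed for formal periods,
"L'application `per` est injective" [Fresan2024, §10.4 Conj. 10.6], [HuberMullerStachPeriods2017,
Conj. 13.2.1], and where stage 1 of the printed chain starts), by the proved comparison
`kzKernelConjecture_iff_isRational` whose right-hand side is verbatim the antecedent.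
[cite: Fresan2024, §10.4 Conj. 10.6] [cite: KontsevichZagier2001, §1.2 Conjecture 1 and §4.1] -/
theorem kzConjecture_implies_ellipticPeriods_algIndep_iff_kernelForm :
    kzConjecture_implies_ellipticPeriods_algIndep ↔
      (Literature.NumberTheory.Transcendental.KZKernelConjecture → EllipticPeriodsAlgIndep) := by
  constructor
  · intro h hk
    exact h (Literature.NumberTheory.Transcendental.kzKernelConjecture_iff_isRational.mp hk)
  · intro h hr
    exact h (Literature.NumberTheory.Transcendental.kzKernelConjecture_iff_isRational.mpr hr)

/-- **All-algebraic form of the barrier.** The fact is equivalently the implication from the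
two-representation form of Conjecture 1 with `ℚ`-semialgebraic (real-algebraic) endpoints,
`KZPeriodConjecture'` (KZ §1.1: "one can replace the words 'rational function' and 'rational
coefficients' by 'algebraic function' and 'algebraic coefficients'"), by the proved comparison
`kzPeriodConjecture'_iff_isRational`. [cite: KontsevichZagier2001, §1.1 (remark after the Definition) and §1.2 Conjecture 1] -/
theorem kzConjecture_implies_ellipticPeriods_algIndep_iff_algebraicForm :
    kzConjecture_implies_ellipticPeriods_algIndep ↔
      (Literature.NumberTheory.Transcendental.KZPeriodConjecture' → EllipticPeriodsAlgIndep) := by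
  constructor
  · intro h hk
    exact h (Literature.NumberTheory.Transcendental.kzPeriodConjecture'_iff_isRational.mp hk)
  · intro h hr
    exact h (Literature.NumberTheory.Transcendental.kzPeriodConjecture'_iff_isRational.mpr hr)

/-- **The bite in kernel form**: under the printed implication, the kernel form of Conjecture 1
(`ker eval = relations`) proves Fresán's Conjecture 10.4 for every non-CM lattice with algebraic
`g₂, g₃`. [cite: Fresan2024, §10.3 Conj. 10.4 and §10.4 Conj. 10.6] -/
theorem algebraicIndependent_ellipticPeriods_of_kzKernel
    (h : kzConjecture_implies_ellipticPeriods_algIndep)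
    (hk : Literature.NumberTheory.Transcendental.KZKernelConjecture)
    (L : PeriodPair) (h₂ : IsAlgebraic ℚ L.g₂) (h₃ : IsAlgebraic ℚ L.g₃) (hCM : NonCM L) :
    AlgebraicIndependent ℚ ![L.ω₁, L.ω₂, L.η₁, L.η₂] :=
  kzConjecture_implies_ellipticPeriods_algIndep_iff_kernelForm.mp h hk L h₂ h₃ hCM

/-- **The bite in kernel form, Chudnovsky's currency**: under the printed implication, the kernel
form of Conjecture 1 gives `trdeg_ℚ ℚ(ω₁, ω₂, η₁, η₂) = 4` for every non-CM lattice with algebraic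
invariants (proved frontier: Chudnovsky's `⩾ 2`, `Literature.NumberTheory.Transcendental.chudnovsky`).
[cite: Fresan2024, Thm. 10.8, Conj. 10.4 and Conj. 10.6] -/
theorem trdeg_ellipticPeriods_eq_four_of_kzKernel
    (h : kzConjecture_implies_ellipticPeriods_algIndep)
    (hk : Literature.NumberTheory.Transcendental.KZKernelConjecture)
    (L : PeriodPair) (h₂ : IsAlgebraic ℚ L.g₂) (h₃ : IsAlgebraic ℚ L.g₃) (hCM : NonCM L) :
    Algebra.trdeg ℚ ↥(IntermediateField.adjoin ℚ ({L.ω₁, L.ω₂, L.η₁, L.η₂} : Set ℂ)) = 4 :=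
  (kzConjecture_implies_ellipticPeriods_algIndep_iff_kernelForm.mp h hk).trdeg_eq_four L h₂ h₃ hCM

/-! ### The mechanism of stages 1–3: move-invariant functionals

Every printed use of Conjecture 1 towards Grothendieck's conjecture goes through functionals on
formal periods other than the evaluation — the evaluations twisted by the points of the period
torsor, i.e. by the motivic Galois group ("l'évaluation des fonctions sur le torseur des périodes en
le point comp" [Fresan2024, §10.4, pp. 147–148]; [HuberMullerStachPeriods2017, §13.2]). On the
calculus of `KZCalculus.lean` such a functional is an additive map `φ : KZ.FormalRep →+ A` vanishing
on `KZ.relations` ("move-invariant"). The two lemmas below are the whole formal content of the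
interaction with the antecedent: Conjecture 1 forces every move-invariant functional to vanish on
`ker eval` (to be a function of the value), and one move-invariant functional separating two
representations of the same number refutes Conjecture 1. A discharge of
`kzConjecture_implies_ellipticPeriods_algIndep` along the printed lines must therefore *construct*
move-invariant functionals on all integral representations (stage 1: the cohomological
interpretation of every representation and of every move) rich enough to separate the polynomial
relations among `ω₁, ω₂, η₁, η₂` (stages 2–3: the `GL₂`-torsor of `H¹(E)`); none is available
without the motivic theory. -/

/-- **Conjecture 1 makes every move-invariant additive functional a function of the value**: if
any two rational integral representations of the same number are connected by the moves (the body
of the summit), then an additive `φ : KZ.FormalRep →+ A` vanishing on `KZ.relations` vanishes on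
every formal combination of value `0` (via the kernel form `kzKernelConjecture_iff_isRational`).
In the motivic theory the twisted evaluations are such `φ`; this is how the period conjecture
transports numerical relations to formal ones [HuberMullerStachPeriods2017, §13.2, Prop. 13.2.6].
[cite: Fresan2024, §10.4 (pp. 147-148)] [cite: KontsevichZagier2001, §4.1] -/
theorem moveInvariant_eq_zero_of_kz
    (hkz : ∀ ⦃n m : ℕ⦄ (r : Literature.NumberTheory.Transcendental.KZ.IntegralRep n)
      (r' : Literature.NumberTheory.Transcendental.KZ.IntegralRep m),
      r.IsRational → r'.IsRational → r.value = r'.value →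
        Literature.NumberTheory.Transcendental.KZ.Equivalent r r')
    {A : Type*} [AddCommGroup A] (φ : Literature.NumberTheory.Transcendental.KZ.FormalRep →+ A)
    (hφ : ∀ c ∈ Literature.NumberTheory.Transcendental.KZ.relations, φ c = 0)
    (c : Literature.NumberTheory.Transcendental.KZ.FormalRep)
    (hc : Literature.NumberTheory.Transcendental.KZ.eval c = 0) : φ c = 0 :=
  hφ c (Literature.NumberTheory.Transcendental.kzKernelConjecture_iff_isRational.mpr hkz c hc)

/-- **… in two-representation form**: under Conjecture 1, a move-invariant additive functional takes
the same value on any two integral representations (of any dimensions, with `ℚ`-semialgebraic data)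
of the same real number. [cite: KontsevichZagier2001, §1.2 Conjecture 1 and §4.1] -/
theorem moveInvariant_apply_of_eq_of_kz
    (hkz : ∀ ⦃n m : ℕ⦄ (r : Literature.NumberTheory.Transcendental.KZ.IntegralRep n)
      (r' : Literature.NumberTheory.Transcendental.KZ.IntegralRep m),
      r.IsRational → r'.IsRational → r.value = r'.value →
        Literature.NumberTheory.Transcendental.KZ.Equivalent r r')
    {A : Type*} [AddCommGroup A] (φ : Literature.NumberTheory.Transcendental.KZ.FormalRep →+ A)
    (hφ : ∀ c ∈ Literature.NumberTheory.Transcendental.KZ.relations, φ c = 0)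
    {n m : ℕ} (r : Literature.NumberTheory.Transcendental.KZ.IntegralRep n)
    (r' : Literature.NumberTheory.Transcendental.KZ.IntegralRep m) (hv : r.value = r'.value) :
    φ (Literature.NumberTheory.Transcendental.KZ.of r) =
      φ (Literature.NumberTheory.Transcendental.KZ.of r') := by
  have h0 := moveInvariant_eq_zero_of_kz hkz φ hφ
    (Literature.NumberTheory.Transcendental.KZ.of r - Literature.NumberTheory.Transcendental.KZ.of r')
    (by rw [Literature.NumberTheory.Transcendental.KZ.eval_of_sub_of, hv, sub_self])
  rwa [map_sub, sub_eq_zero] at h0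

/-- **A separating move-invariant functional refutes Conjecture 1** (contrapositive of
`moveInvariant_apply_of_eq_of_kz`): an additive invariant of the four move sets of
`KZCalculus.lean` distinguishing two integral representations of the same number disproves the
rules form of Conjecture 1 — and would discharge the present barrier fact vacuously. This is the
kill criterion recorded by the summit's route `NoriTransfer` ("an additive invariant of FormalRep
vanishing on the four move sets"); no such invariant other than functions of the value is known.
[cite: KontsevichZagier2001, §1.2 Conjecture 1 and §4.1] -/
theorem not_kz_of_moveInvariant_separating
    {A : Type*} [AddCommGroup A] (φ : Literature.NumberTheory.Transcendental.KZ.FormalRep →+ A)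
    (hφ : ∀ c ∈ Literature.NumberTheory.Transcendental.KZ.relations, φ c = 0)
    {n m : ℕ} (r : Literature.NumberTheory.Transcendental.KZ.IntegralRep n)
    (r' : Literature.NumberTheory.Transcendental.KZ.IntegralRep m) (hv : r.value = r'.value)
    (hsep : φ (Literature.NumberTheory.Transcendental.KZ.of r) ≠
      φ (Literature.NumberTheory.Transcendental.KZ.of r')) :
    ¬ ∀ ⦃n m : ℕ⦄ (r : Literature.NumberTheory.Transcendental.KZ.IntegralRep n)
      (r' : Literature.NumberTheory.Transcendental.KZ.IntegralRep m),
      r.IsRational → r'.IsRational → r.value = r'.value →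
        Literature.NumberTheory.Transcendental.KZ.Equivalent r r' :=
  fun hkz => hsep (moveInvariant_apply_of_eq_of_kz hkz φ hφ r r' hv)

end Literature.Barriers.KontsevichZagierPeriods
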